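import Summits.HodgeConjecture.HodgeConjecture.Theses.AnchorTransport
import Summits.HodgeConjecture.HodgeConjecture.Theses.QbarEnvelope
import Summits.HodgeConjecture.HodgeConjecture.Theorems.AnchorTransportTargetIffHodgeConjecture
import Literature.AlgebraicGeometry.HodgeTheory.MotivatedClassesLefschetzRange
import Literature.AlgebraicGeometry.HodgeTheory.LefschetzOneOneHolds
import Literature.AlgebraicGeometry.HodgeTheory.HardLefschetzNFoldHolds

/-!
# Route AnchorTransport — crux `AnchorExistence` (stmt-HodgeConjecture-1077) · glue of the line `qbar-fibre-anchors`

Kernel-checked glue of the line `qbar-fibre-anchors` (crux-strategist card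
`Cruxes/AnchorExistence/Lines/qbar-fibre-anchors.md`, skeleton `Cruxes/AnchorExistence/Lines/qbar_fibre_anchors.lean`,
lead c5 2026-08-17), stated over existing declarations only (every route-posited notion is INLINED, as in the
registered stubs):

* `anchorExistence_of_hcOverNumberFields_of_qbarFibreAnchors` — THE LINE IN ONE SENTENCE: the shared crux
  `QbarEnvelope.HCOverNumberFields` (stmt-HodgeConjecture-1070) together with **ℚ̄-fibre anchors** ("every
  rational `(p,p)` class on a smooth projective `X` is carried, inside ONE smooth projective family over a smooth
  irreducible base with ONE global fibrewise rational `(p,p)` class restricting to it, to a fibre DEFINABLE OVER A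
  NUMBER FIELD") gives `AnchorExistence`: the Hodge conjecture over number fields turns the `ℚ̄`-fibre into an
  algebraic anchor.  This is the glue for the planners' split of stmt-1077 into `[stmt-1070, QbarFibreAnchors]`.
* `anchorExistence_of_hcOverNumberFields_of_rigid_of_pairRigid_of_pairMovable` — the finer glue along the
  strategist's case split, with the Lefschetz range DISCHARGED: `HCOverNumberFields`, descent of extrinsically
  rigid varieties to number fields (registered stub `stub_definable_of_rigid`, known in print), the dark case
  "pair-rigid ⟹ definable over a number field" and the `ℚ̄`-geography "pair-movable ⟹ `ℚ̄`-fibre anchor", the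
  last two only in the MIDDLE RANGE `2 ≤ p ≤ n - 2` (for `p ≤ 1 ∨ n ≤ p + 1` the class is algebraic on `X`
  itself by Lefschetz `(1,1)` and hard Lefschetz, theorems of the tree, and the constant family anchors it).
* `qbarFibreAnchors_of_rigid_of_pairRigid_of_pairMovable` and the three converses
  `definable_of_rigid_of_qbarFibreAnchors`, `definable_of_pairRigid_of_qbarFibreAnchors`,
  `qbarFibreAnchor_of_pairMovable_of_qbarFibreAnchors` — the case split is LOSSLESS: the three non-shared stubs
  of the line are together equivalent to `ℚ̄`-fibre anchors for all pairs (`qbarFibreAnchors_iff`).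

## References

* [Voisin2007HodgeLoci] C. Voisin, Hodge loci and absolute Hodge classes, Compositio Math. 143 (2007), Prop. 1.2,
  Prop. 1.7 and the isolated-point caveat of §0.
* [CharlesSchnell2014Notes] F. Charles, C. Schnell, Notes on absolute Hodge classes, Thm. 11.3.19.
* [KlinglerOtwinowskaUrbanik2023] B. Klingler, A. Otwinowska, D. Urbanik, On the fields of definition of Hodge
  loci, Thm. 1.12, Cor. 1.13–1.14.
-/

noncomputable section

-- The mandated namespace `Summit.<P>.<Sub>.Theorems.…` repeats `HodgeConjecture` (single-conjunct summit).
set_option linter.dupNamespace false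

namespace Summit.HodgeConjecture.HodgeConjecture.Theorems.QbarFibreAnchors

open CategoryTheory AlgebraicGeometry
open Literature.AlgebraicGeometry Literature.AlgebraicGeometry.Motives
  Literature.AlgebraicGeometry.HodgeTheory Literature.AlgebraicTopology.SingularHomology
open Summit.HodgeConjecture.HodgeConjecture.Theses.AnchorTransport

/-! ### The line in one sentence -/

/-- **`HCOverNumberFields ∧ ℚ̄-fibre anchors → AnchorExistence`.**  If every rational `(p,p)` class `c` on a
smooth projective complex `n`-fold `X` is carried by a Hodge datum (smooth projective family `f : 𝒳 ⟶ S` of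
relative dimension `n` over a smooth irreducible `ℂ`-scheme, global class `A` fibrewise rational of type `(p,p)`,
`e : X ≅ 𝒳_{s₁}` with `e^*(A|_{𝒳_{s₁}}) = c`) to a fibre `𝒳_{s₀}` definable over a number field, then the Hodge
conjecture over number fields (the shared crux `QbarEnvelope.HCOverNumberFields`, stmt-HodgeConjecture-1070)
makes `A|_{𝒳_{s₀}}` algebraic there (`𝒳_{s₀}` is smooth projective of dimension `n`,
`IsSmoothProjectiveFamily.isSmoothProjective`), which is an anchor datum for `(X, c)`.
[cite: Voisin2007HodgeLoci, Prop. 1.2 and Prop. 1.7] -/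
theorem anchorExistence_of_hcOverNumberFields_of_qbarFibreAnchors :
    Summit.HodgeConjecture.HodgeConjecture.Theses.QbarEnvelope.HCOverNumberFields →
    (∀ ⦃n : ℕ⦄ ⦃X : SchemeOver ℂ⦄, IsSmoothProjective n X →
      ∀ (p : ℕ) (c : complexBetti X (2 * p)), IsRationalClass c → IsOfHodgeType n X (2 * p) p p c →
      ∃ (𝒳 S : SchemeOver ℂ) (f : 𝒳 ⟶ S) (s₁ s₀ : ComplexPoints S) (e : X ≅ fiberOver f s₁)
        (A : complexBetti 𝒳 (2 * p)),
        IsSmoothProjectiveFamily f n ∧ IrreducibleSpace S.left ∧ AlgebraicGeometry.Smooth S.hom ∧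
        (∀ s : ComplexPoints S, IsRationalClass (complexBetti.map (fiberι f s) (2 * p) A) ∧
          IsOfHodgeType n (fiberOver f s) (2 * p) p p (complexBetti.map (fiberι f s) (2 * p) A)) ∧
        complexBetti.map e.hom (2 * p) (complexBetti.map (fiberι f s₁) (2 * p) A) = c ∧
        ∃ (K : Type) (_ : Field K) (_ : NumberField K) (σ : K →+* ℂ) (X₀ : SchemeOver K),
          Nonempty (fiberOver f s₀ ≅ (baseChangeHom σ).obj X₀)) →
    AnchorExistence := by
  intro hC1 hQ n X hX p c hc hpp
  obtain ⟨𝒳, S, f, s₁, s₀, e, A, hf, hirr, hsm, hfib, hAc, hdef⟩ := hQ hX p c hc hpp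
  exact ⟨𝒳, S, f, s₁, s₀, e, A, hf, hirr, hsm, hfib, hAc,
    (hC1 (hf.isSmoothProjective s₀) hdef).2 p _ (hfib s₀).1 (hfib s₀).2⟩

/-! ### The finer glue: rigid / pair-rigid / pair-movable, middle range only -/

/-- **`AnchorExistence` from the shared crux and the three sectors of ℚ̄-fibre anchors, Lefschetz range
discharged.**  Hypotheses: (1) `HCOverNumberFields`; (2) an extrinsically rigid smooth projective `X` (every
fibre of every smooth projective family of relative dimension `n` over a smooth irreducible base having `X` as a
fibre is `≅ X`) is definable over a number field; (3) THE DARK CASE in the middle range `2 ≤ p ≤ n - 2`: `X`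
extrinsically movable but `(X, c)` pair-rigid (every Hodge-class-carrying such family through `(X, c)` is
fibrewise `≅ X`) ⟹ `X` definable over a number field; (4) THE ℚ̄-GEOGRAPHY in the middle range: `(X, c)`
pair-movable ⟹ a Hodge datum through `(X, c)` with a fibre definable over a number field.  Proof: for
`p ≤ 1 ∨ n ≤ p + 1` the class is algebraic on `X` (Lefschetz `(1,1)` and hard Lefschetz,
`mem_algebraicClasses_of_lefschetzRange` with the tree's `lefschetzOneOne_rational_holds`,
`nonempty_hardLefschetzNFold_holds`) and the constant family anchors it
(`anchorTransport_anchor_of_mem_algebraicClasses`); otherwise case split on extrinsic and pair rigidity — in the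
two rigid cases `X` is a `ℚ̄`-variety by (2)/(3), (1) makes `c` algebraic, constant family; in the pair-movable
case (4) gives a `ℚ̄`-fibre, algebraic anchor by (1). [cite: Voisin2007HodgeLoci, Prop. 1.2 and §0]
[cite: KlinglerOtwinowskaUrbanik2023, Thm. 1.12] -/
theorem anchorExistence_of_hcOverNumberFields_of_rigid_of_pairRigid_of_pairMovable :
    Summit.HodgeConjecture.HodgeConjecture.Theses.QbarEnvelope.HCOverNumberFields →
    (∀ ⦃n : ℕ⦄ ⦃X : SchemeOver ℂ⦄, IsSmoothProjective n X →
      (∀ ⦃𝒳 S : SchemeOver ℂ⦄ (f : 𝒳 ⟶ S) (s₁ s₀ : ComplexPoints S),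
        IsSmoothProjectiveFamily f n → IrreducibleSpace S.left → AlgebraicGeometry.Smooth S.hom →
        Nonempty (X ≅ fiberOver f s₁) → Nonempty (X ≅ fiberOver f s₀)) →
      ∃ (K : Type) (_ : Field K) (_ : NumberField K) (σ : K →+* ℂ) (X₀ : SchemeOver K),
        Nonempty (X ≅ (baseChangeHom σ).obj X₀)) →
    (∀ ⦃n : ℕ⦄ ⦃X : SchemeOver ℂ⦄, IsSmoothProjective n X →
      ¬ (∀ ⦃𝒳 S : SchemeOver ℂ⦄ (f : 𝒳 ⟶ S) (s₁ s₀ : ComplexPoints S),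
        IsSmoothProjectiveFamily f n → IrreducibleSpace S.left → AlgebraicGeometry.Smooth S.hom →
        Nonempty (X ≅ fiberOver f s₁) → Nonempty (X ≅ fiberOver f s₀)) →
      ∀ (p : ℕ) (c : complexBetti X (2 * p)), IsRationalClass c → IsOfHodgeType n X (2 * p) p p c →
      2 ≤ p → p + 2 ≤ n →
      (∀ ⦃𝒳 S : SchemeOver ℂ⦄ (f : 𝒳 ⟶ S) (s₁ s₀ : ComplexPoints S) (e : X ≅ fiberOver f s₁)
          (A : complexBetti 𝒳 (2 * p)),
        IsSmoothProjectiveFamily f n → IrreducibleSpace S.left → AlgebraicGeometry.Smooth S.hom →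
        (∀ s : ComplexPoints S, IsRationalClass (complexBetti.map (fiberι f s) (2 * p) A) ∧
          IsOfHodgeType n (fiberOver f s) (2 * p) p p (complexBetti.map (fiberι f s) (2 * p) A)) →
        complexBetti.map e.hom (2 * p) (complexBetti.map (fiberι f s₁) (2 * p) A) = c →
        Nonempty (X ≅ fiberOver f s₀)) →
      ∃ (K : Type) (_ : Field K) (_ : NumberField K) (σ : K →+* ℂ) (X₀ : SchemeOver K),
        Nonempty (X ≅ (baseChangeHom σ).obj X₀)) →
    (∀ ⦃n : ℕ⦄ ⦃X : SchemeOver ℂ⦄, IsSmoothProjective n X →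
      ∀ (p : ℕ) (c : complexBetti X (2 * p)), IsRationalClass c → IsOfHodgeType n X (2 * p) p p c →
      2 ≤ p → p + 2 ≤ n →
      ¬ (∀ ⦃𝒳 S : SchemeOver ℂ⦄ (f : 𝒳 ⟶ S) (s₁ s₀ : ComplexPoints S) (e : X ≅ fiberOver f s₁)
          (A : complexBetti 𝒳 (2 * p)),
        IsSmoothProjectiveFamily f n → IrreducibleSpace S.left → AlgebraicGeometry.Smooth S.hom →
        (∀ s : ComplexPoints S, IsRationalClass (complexBetti.map (fiberι f s) (2 * p) A) ∧
          IsOfHodgeType n (fiberOver f s) (2 * p) p p (complexBetti.map (fiberι f s) (2 * p) A)) →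
        complexBetti.map e.hom (2 * p) (complexBetti.map (fiberι f s₁) (2 * p) A) = c →
        Nonempty (X ≅ fiberOver f s₀)) →
      ∃ (𝒳 S : SchemeOver ℂ) (f : 𝒳 ⟶ S) (s₁ s₀ : ComplexPoints S) (e : X ≅ fiberOver f s₁)
        (A : complexBetti 𝒳 (2 * p)),
        IsSmoothProjectiveFamily f n ∧ IrreducibleSpace S.left ∧ AlgebraicGeometry.Smooth S.hom ∧
        (∀ s : ComplexPoints S, IsRationalClass (complexBetti.map (fiberι f s) (2 * p) A) ∧
          IsOfHodgeType n (fiberOver f s) (2 * p) p p (complexBetti.map (fiberι f s) (2 * p) A)) ∧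
        complexBetti.map e.hom (2 * p) (complexBetti.map (fiberι f s₁) (2 * p) A) = c ∧
        ∃ (K : Type) (_ : Field K) (_ : NumberField K) (σ : K →+* ℂ) (X₀ : SchemeOver K),
          Nonempty (fiberOver f s₀ ≅ (baseChangeHom σ).obj X₀)) →
    AnchorExistence := by
  intro hC1 hR hD hQ n X hX p c hc hpp
  -- the Lefschetz range `p ≤ 1 ∨ n ≤ p + 1` is unconditional: `c` is algebraic on `X` itself
  by_cases hLef : p ≤ 1 ∨ n ≤ p + 1
  · exact anchorTransport_anchor_of_mem_algebraicClasses hX p c hc hpp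
      (mem_algebraicClasses_of_lefschetzRange lefschetzOneOne_rational_holds
        (nonempty_hardLefschetzNFold_holds n X) hX hLef c hc hpp)
  have hp2 : 2 ≤ p := by omega
  have hpn : p + 2 ≤ n := by omega
  by_cases hrig : ∀ ⦃𝒳 S : SchemeOver ℂ⦄ (f : 𝒳 ⟶ S) (s₁ s₀ : ComplexPoints S),
      IsSmoothProjectiveFamily f n → IrreducibleSpace S.left → AlgebraicGeometry.Smooth S.hom →
      Nonempty (X ≅ fiberOver f s₁) → Nonempty (X ≅ fiberOver f s₀)
  · -- extrinsically rigid: `X` is a `ℚ̄`-variety (2); HC over number fields (1); constant family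
    exact anchorTransport_anchor_of_mem_algebraicClasses hX p c hc hpp ((hC1 hX (hR hX hrig)).2 p c hc hpp)
  by_cases hpr : ∀ ⦃𝒳 S : SchemeOver ℂ⦄ (f : 𝒳 ⟶ S) (s₁ s₀ : ComplexPoints S) (e : X ≅ fiberOver f s₁)
        (A : complexBetti 𝒳 (2 * p)),
      IsSmoothProjectiveFamily f n → IrreducibleSpace S.left → AlgebraicGeometry.Smooth S.hom →
      (∀ s : ComplexPoints S, IsRationalClass (complexBetti.map (fiberι f s) (2 * p) A) ∧
        IsOfHodgeType n (fiberOver f s) (2 * p) p p (complexBetti.map (fiberι f s) (2 * p) A)) →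
      complexBetti.map e.hom (2 * p) (complexBetti.map (fiberι f s₁) (2 * p) A) = c →
      Nonempty (X ≅ fiberOver f s₀)
  · -- pair-rigid, middle range (the dark case): again a `ℚ̄`-variety (3); (1); constant family
    exact anchorTransport_anchor_of_mem_algebraicClasses hX p c hc hpp
      ((hC1 hX (hD hX hrig p c hc hpp hp2 hpn hpr)).2 p c hc hpp)
  · -- pair-movable, middle range: a `ℚ̄`-fibre (4), algebraic anchor by (1)
    obtain ⟨𝒳, S, f, s₁, s₀, e, A, hf, hirr, hsm, hfib, hAc, hdef⟩ := hQ hX p c hc hpp hp2 hpn hpr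
    exact ⟨𝒳, S, f, s₁, s₀, e, A, hf, hirr, hsm, hfib, hAc,
      (hC1 (hf.isSmoothProjective s₀) hdef).2 p _ (hfib s₀).1 (hfib s₀).2⟩

/-! ### The case split is lossless: ℚ̄-fibre anchors ⟺ (rigid ∧ pair-rigid ∧ pair-movable sectors) -/

/-- **A `ℚ̄`-variety anchors all its pairs by the constant family**: if `X` itself is definable over a number
field, every rational `(p,p)` class `c` on `X` has a `ℚ̄`-fibre anchor — the constant family `X ⟶ Spec ℂ`,
`s₁ = s₀ = 𝟙`, whose fibre is `≅ X` (`isIso_fiberι_toSpecOver`). [folklore] -/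
theorem qbarFibreAnchor_of_definable {n p : ℕ} {X : SchemeOver ℂ} (hX : IsSmoothProjective n X)
    (c : complexBetti X (2 * p)) (hc : IsRationalClass c) (hpp : IsOfHodgeType n X (2 * p) p p c)
    (hdef : ∃ (K : Type) (_ : Field K) (_ : NumberField K) (σ : K →+* ℂ) (X₀ : SchemeOver K),
      Nonempty (X ≅ (baseChangeHom σ).obj X₀)) :
    ∃ (𝒳 S : SchemeOver ℂ) (f : 𝒳 ⟶ S) (s₁ s₀ : ComplexPoints S) (e : X ≅ fiberOver f s₁)
      (A : complexBetti 𝒳 (2 * p)),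
      IsSmoothProjectiveFamily f n ∧ IrreducibleSpace S.left ∧ AlgebraicGeometry.Smooth S.hom ∧
      (∀ s : ComplexPoints S, IsRationalClass (complexBetti.map (fiberι f s) (2 * p) A) ∧
        IsOfHodgeType n (fiberOver f s) (2 * p) p p (complexBetti.map (fiberι f s) (2 * p) A)) ∧
      complexBetti.map e.hom (2 * p) (complexBetti.map (fiberι f s₁) (2 * p) A) = c ∧
      ∃ (K : Type) (_ : Field K) (_ : NumberField K) (σ : K →+* ℂ) (X₀ : SchemeOver K),
        Nonempty (fiberOver f s₀ ≅ (baseChangeHom σ).obj X₀) := by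
  haveI : ∀ s : AlgPoints (specOver ℂ ℂ) ℂ, IsIso (fiberι (toSpecOver X) s) :=
    isIso_fiberι_toSpecOver
  obtain ⟨K, _, _, σ, X₀, ⟨e₀⟩⟩ := hdef
  refine ⟨X, specOver ℂ ℂ, toSpecOver X, 𝟙 _, 𝟙 _, (asIso (fiberι (toSpecOver X) (𝟙 _))).symm, c,
    isSmoothProjectiveFamily_toSpecOver hX, irreducibleSpace_specOver_left, smooth_specOver_hom,
    fun s ↦ ⟨?_, ?_⟩, ?_, ⟨K, inferInstance, inferInstance, σ, X₀,
      ⟨asIso (fiberι (toSpecOver X) (𝟙 _)) ≪≫ e₀⟩⟩⟩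
  · exact hc.pullback _
  · exact IsOfHodgeType.map_of_iso (asIso (fiberι (toSpecOver X) s)) hpp
  · change (complexBetti.map (asIso (fiberι (toSpecOver X) (𝟙 _))).hom (2 * p) ≫
      complexBetti.map (asIso (fiberι (toSpecOver X) (𝟙 _))).inv (2 * p)) c = c
    rw [← complexBetti.map_comp, Iso.inv_hom_id, complexBetti.map_id]
    rfl

/-- **The three sectors ⟹ ℚ̄-fibre anchors for every pair** (case split on extrinsic / pair rigidity; the rigid
cases anchor by the constant family of the `ℚ̄`-variety `X`, `qbarFibreAnchor_of_definable`).
[cite: Voisin2007HodgeLoci, Prop. 1.7] -/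
theorem qbarFibreAnchors_of_rigid_of_pairRigid_of_pairMovable
    (hR : ∀ ⦃n : ℕ⦄ ⦃X : SchemeOver ℂ⦄, IsSmoothProjective n X →
      (∀ ⦃𝒳 S : SchemeOver ℂ⦄ (f : 𝒳 ⟶ S) (s₁ s₀ : ComplexPoints S),
        IsSmoothProjectiveFamily f n → IrreducibleSpace S.left → AlgebraicGeometry.Smooth S.hom →
        Nonempty (X ≅ fiberOver f s₁) → Nonempty (X ≅ fiberOver f s₀)) →
      ∃ (K : Type) (_ : Field K) (_ : NumberField K) (σ : K →+* ℂ) (X₀ : SchemeOver K),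
        Nonempty (X ≅ (baseChangeHom σ).obj X₀))
    (hD : ∀ ⦃n : ℕ⦄ ⦃X : SchemeOver ℂ⦄, IsSmoothProjective n X →
      ¬ (∀ ⦃𝒳 S : SchemeOver ℂ⦄ (f : 𝒳 ⟶ S) (s₁ s₀ : ComplexPoints S),
        IsSmoothProjectiveFamily f n → IrreducibleSpace S.left → AlgebraicGeometry.Smooth S.hom →
        Nonempty (X ≅ fiberOver f s₁) → Nonempty (X ≅ fiberOver f s₀)) →
      ∀ (p : ℕ) (c : complexBetti X (2 * p)), IsRationalClass c → IsOfHodgeType n X (2 * p) p p c →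
      (∀ ⦃𝒳 S : SchemeOver ℂ⦄ (f : 𝒳 ⟶ S) (s₁ s₀ : ComplexPoints S) (e : X ≅ fiberOver f s₁)
          (A : complexBetti 𝒳 (2 * p)),
        IsSmoothProjectiveFamily f n → IrreducibleSpace S.left → AlgebraicGeometry.Smooth S.hom →
        (∀ s : ComplexPoints S, IsRationalClass (complexBetti.map (fiberι f s) (2 * p) A) ∧
          IsOfHodgeType n (fiberOver f s) (2 * p) p p (complexBetti.map (fiberι f s) (2 * p) A)) →
        complexBetti.map e.hom (2 * p) (complexBetti.map (fiberι f s₁) (2 * p) A) = c →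
        Nonempty (X ≅ fiberOver f s₀)) →
      ∃ (K : Type) (_ : Field K) (_ : NumberField K) (σ : K →+* ℂ) (X₀ : SchemeOver K),
        Nonempty (X ≅ (baseChangeHom σ).obj X₀))
    (hQ : ∀ ⦃n : ℕ⦄ ⦃X : SchemeOver ℂ⦄, IsSmoothProjective n X →
      ∀ (p : ℕ) (c : complexBetti X (2 * p)), IsRationalClass c → IsOfHodgeType n X (2 * p) p p c →
      ¬ (∀ ⦃𝒳 S : SchemeOver ℂ⦄ (f : 𝒳 ⟶ S) (s₁ s₀ : ComplexPoints S) (e : X ≅ fiberOver f s₁)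
          (A : complexBetti 𝒳 (2 * p)),
        IsSmoothProjectiveFamily f n → IrreducibleSpace S.left → AlgebraicGeometry.Smooth S.hom →
        (∀ s : ComplexPoints S, IsRationalClass (complexBetti.map (fiberι f s) (2 * p) A) ∧
          IsOfHodgeType n (fiberOver f s) (2 * p) p p (complexBetti.map (fiberι f s) (2 * p) A)) →
        complexBetti.map e.hom (2 * p) (complexBetti.map (fiberι f s₁) (2 * p) A) = c →
        Nonempty (X ≅ fiberOver f s₀)) →
      ∃ (𝒳 S : SchemeOver ℂ) (f : 𝒳 ⟶ S) (s₁ s₀ : ComplexPoints S) (e : X ≅ fiberOver f s₁)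
        (A : complexBetti 𝒳 (2 * p)),
        IsSmoothProjectiveFamily f n ∧ IrreducibleSpace S.left ∧ AlgebraicGeometry.Smooth S.hom ∧
        (∀ s : ComplexPoints S, IsRationalClass (complexBetti.map (fiberι f s) (2 * p) A) ∧
          IsOfHodgeType n (fiberOver f s) (2 * p) p p (complexBetti.map (fiberι f s) (2 * p) A)) ∧
        complexBetti.map e.hom (2 * p) (complexBetti.map (fiberι f s₁) (2 * p) A) = c ∧
        ∃ (K : Type) (_ : Field K) (_ : NumberField K) (σ : K →+* ℂ) (X₀ : SchemeOver K),
          Nonempty (fiberOver f s₀ ≅ (baseChangeHom σ).obj X₀))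
    {n : ℕ} {X : SchemeOver ℂ} (hX : IsSmoothProjective n X) (p : ℕ) (c : complexBetti X (2 * p))
    (hc : IsRationalClass c) (hpp : IsOfHodgeType n X (2 * p) p p c) :
    ∃ (𝒳 S : SchemeOver ℂ) (f : 𝒳 ⟶ S) (s₁ s₀ : ComplexPoints S) (e : X ≅ fiberOver f s₁)
      (A : complexBetti 𝒳 (2 * p)),
      IsSmoothProjectiveFamily f n ∧ IrreducibleSpace S.left ∧ AlgebraicGeometry.Smooth S.hom ∧
      (∀ s : ComplexPoints S, IsRationalClass (complexBetti.map (fiberι f s) (2 * p) A) ∧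
        IsOfHodgeType n (fiberOver f s) (2 * p) p p (complexBetti.map (fiberι f s) (2 * p) A)) ∧
      complexBetti.map e.hom (2 * p) (complexBetti.map (fiberι f s₁) (2 * p) A) = c ∧
      ∃ (K : Type) (_ : Field K) (_ : NumberField K) (σ : K →+* ℂ) (X₀ : SchemeOver K),
        Nonempty (fiberOver f s₀ ≅ (baseChangeHom σ).obj X₀) := by
  by_cases hrig : ∀ ⦃𝒳 S : SchemeOver ℂ⦄ (f : 𝒳 ⟶ S) (s₁ s₀ : ComplexPoints S),
      IsSmoothProjectiveFamily f n → IrreducibleSpace S.left → AlgebraicGeometry.Smooth S.hom →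
      Nonempty (X ≅ fiberOver f s₁) → Nonempty (X ≅ fiberOver f s₀)
  · exact qbarFibreAnchor_of_definable hX c hc hpp (hR hX hrig)
  by_cases hpr : ∀ ⦃𝒳 S : SchemeOver ℂ⦄ (f : 𝒳 ⟶ S) (s₁ s₀ : ComplexPoints S) (e : X ≅ fiberOver f s₁)
        (A : complexBetti 𝒳 (2 * p)),
      IsSmoothProjectiveFamily f n → IrreducibleSpace S.left → AlgebraicGeometry.Smooth S.hom →
      (∀ s : ComplexPoints S, IsRationalClass (complexBetti.map (fiberι f s) (2 * p) A) ∧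
        IsOfHodgeType n (fiberOver f s) (2 * p) p p (complexBetti.map (fiberι f s) (2 * p) A)) →
      complexBetti.map e.hom (2 * p) (complexBetti.map (fiberι f s₁) (2 * p) A) = c →
      Nonempty (X ≅ fiberOver f s₀)
  · exact qbarFibreAnchor_of_definable hX c hc hpp (hD hX hrig p c hc hpp hpr)
  · exact hQ hX p c hc hpp hpr

/-- **ℚ̄-fibre anchors ⟹ the rigid sector, read backwards**: on the pair `(X, 0)` in degree `0` the `ℚ̄`-fibre of
a `ℚ̄`-fibre anchor of an extrinsically rigid `X` is `≅ X`, so `X` is definable over a number field (`0` is a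
rational class of every type: `IsRationalClass.zero`, `isOfHodgeType_zero_of_isSmoothProjective` with the tree's
`nonempty_hodgeModel_holds`). [cite: Voisin2007HodgeLoci, §0] -/
theorem definable_of_rigid_of_qbarFibreAnchors
    (h : ∀ ⦃n : ℕ⦄ ⦃X : SchemeOver ℂ⦄, IsSmoothProjective n X →
      ∀ (p : ℕ) (c : complexBetti X (2 * p)), IsRationalClass c → IsOfHodgeType n X (2 * p) p p c →
      ∃ (𝒳 S : SchemeOver ℂ) (f : 𝒳 ⟶ S) (s₁ s₀ : ComplexPoints S) (e : X ≅ fiberOver f s₁)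
        (A : complexBetti 𝒳 (2 * p)),
        IsSmoothProjectiveFamily f n ∧ IrreducibleSpace S.left ∧ AlgebraicGeometry.Smooth S.hom ∧
        (∀ s : ComplexPoints S, IsRationalClass (complexBetti.map (fiberι f s) (2 * p) A) ∧
          IsOfHodgeType n (fiberOver f s) (2 * p) p p (complexBetti.map (fiberι f s) (2 * p) A)) ∧
        complexBetti.map e.hom (2 * p) (complexBetti.map (fiberι f s₁) (2 * p) A) = c ∧
        ∃ (K : Type) (_ : Field K) (_ : NumberField K) (σ : K →+* ℂ) (X₀ : SchemeOver K),
          Nonempty (fiberOver f s₀ ≅ (baseChangeHom σ).obj X₀))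
    {n : ℕ} {X : SchemeOver ℂ} (hX : IsSmoothProjective n X)
    (hrig : ∀ ⦃𝒳 S : SchemeOver ℂ⦄ (f : 𝒳 ⟶ S) (s₁ s₀ : ComplexPoints S),
      IsSmoothProjectiveFamily f n → IrreducibleSpace S.left → AlgebraicGeometry.Smooth S.hom →
      Nonempty (X ≅ fiberOver f s₁) → Nonempty (X ≅ fiberOver f s₀)) :
    ∃ (K : Type) (_ : Field K) (_ : NumberField K) (σ : K →+* ℂ) (X₀ : SchemeOver K),
      Nonempty (X ≅ (baseChangeHom σ).obj X₀) := by
  obtain ⟨𝒳, S, f, s₁, s₀, e, A, hf, hirr, hsm, -, -, K, _, _, σ, X₀, ⟨e₀⟩⟩ :=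
    h hX 0 0 IsRationalClass.zero (isOfHodgeType_zero_of_isSmoothProjective nonempty_hodgeModel_holds hX _ 0 0)
  obtain ⟨g⟩ := hrig f s₁ s₀ hf hirr hsm ⟨e⟩
  exact ⟨K, inferInstance, inferInstance, σ, X₀, ⟨g ≪≫ e₀⟩⟩

/-- **ℚ̄-fibre anchors ⟹ the dark sector, read backwards**: on a pair-rigid `(X, c)` the `ℚ̄`-fibre of a
`ℚ̄`-fibre anchor is `≅ X`, so `X` is definable over a number field (the extrinsic-movability hypothesis of
the registered stub is not even needed). [cite: Voisin2007HodgeLoci, §0] -/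
theorem definable_of_pairRigid_of_qbarFibreAnchors
    (h : ∀ ⦃n : ℕ⦄ ⦃X : SchemeOver ℂ⦄, IsSmoothProjective n X →
      ∀ (p : ℕ) (c : complexBetti X (2 * p)), IsRationalClass c → IsOfHodgeType n X (2 * p) p p c →
      ∃ (𝒳 S : SchemeOver ℂ) (f : 𝒳 ⟶ S) (s₁ s₀ : ComplexPoints S) (e : X ≅ fiberOver f s₁)
        (A : complexBetti 𝒳 (2 * p)),
        IsSmoothProjectiveFamily f n ∧ IrreducibleSpace S.left ∧ AlgebraicGeometry.Smooth S.hom ∧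
        (∀ s : ComplexPoints S, IsRationalClass (complexBetti.map (fiberι f s) (2 * p) A) ∧
          IsOfHodgeType n (fiberOver f s) (2 * p) p p (complexBetti.map (fiberι f s) (2 * p) A)) ∧
        complexBetti.map e.hom (2 * p) (complexBetti.map (fiberι f s₁) (2 * p) A) = c ∧
        ∃ (K : Type) (_ : Field K) (_ : NumberField K) (σ : K →+* ℂ) (X₀ : SchemeOver K),
          Nonempty (fiberOver f s₀ ≅ (baseChangeHom σ).obj X₀))
    {n : ℕ} {X : SchemeOver ℂ} (hX : IsSmoothProjective n X) (p : ℕ) (c : complexBetti X (2 * p))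
    (hc : IsRationalClass c) (hpp : IsOfHodgeType n X (2 * p) p p c)
    (hpr : ∀ ⦃𝒳 S : SchemeOver ℂ⦄ (f : 𝒳 ⟶ S) (s₁ s₀ : ComplexPoints S) (e : X ≅ fiberOver f s₁)
        (A : complexBetti 𝒳 (2 * p)),
      IsSmoothProjectiveFamily f n → IrreducibleSpace S.left → AlgebraicGeometry.Smooth S.hom →
      (∀ s : ComplexPoints S, IsRationalClass (complexBetti.map (fiberι f s) (2 * p) A) ∧
        IsOfHodgeType n (fiberOver f s) (2 * p) p p (complexBetti.map (fiberι f s) (2 * p) A)) →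
      complexBetti.map e.hom (2 * p) (complexBetti.map (fiberι f s₁) (2 * p) A) = c →
      Nonempty (X ≅ fiberOver f s₀)) :
    ∃ (K : Type) (_ : Field K) (_ : NumberField K) (σ : K →+* ℂ) (X₀ : SchemeOver K),
      Nonempty (X ≅ (baseChangeHom σ).obj X₀) := by
  obtain ⟨𝒳, S, f, s₁, s₀, e, A, hf, hirr, hsm, hfib, hAc, K, _, _, σ, X₀, ⟨e₀⟩⟩ := h hX p c hc hpp
  obtain ⟨g⟩ := hpr f s₁ s₀ e A hf hirr hsm hfib hAc
  exact ⟨K, inferInstance, inferInstance, σ, X₀, ⟨g ≪≫ e₀⟩⟩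

end Summit.HodgeConjecture.HodgeConjecture.Theorems.QbarFibreAnchors

end
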